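import HarnessLib
import Literature.NumberTheory.LFunctions.WeilFirstPrimePositivityC
import Summits.Ventures.WeilGRH.BaseRungComplete
import Summits.Ventures.WeilGRH.RealCharacterSmallModuli
import Summits.Ventures.WeilGRH.CellMod3Log3Half
import Summits.Ventures.WeilGRH.CellMod5Log3Half
import Summits.Ventures.WeilGRH.DualTrigCertMod4OddLog3Half
import Summits.Ventures.WeilGRH.DualTrigCertMod5OddChi2ILog3Half
import Summits.Ventures.WeilGRH.DualTrigCertMod5OddChi2NegILog3Half
import Summits.Ventures.WeilGRH.MinorantZetaTransferOddRungs
import Summits.Ventures.WeilGRH.ReflectionRungsSmallModuli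

/-!
# The `ζ` base rung `(log 3)/2` for EVERY primitive Dirichlet character of every modulus

Cell `rh-explicit`, WEIL TRACK — GRH ARM (engine seat weil-grh-2 gen8).  Assembly of the tree's theorems at the window
`a = (log 3)/2` (Yoshida's base rung for `ζ`, `weilPositivityOn_log_three_half`):

* `q ≥ 10`: `weilPositivityOnChar_log_three_half_of_ge_ten` (reflection transfer, weil-grh-2 gen≤6);
* `q = 9`: `…_mod_nine` (`χ(2) ≠ 1`, automatic for `χ ≠ 1` since `2` generates `(ℤ/9)ˣ`);
* `q = 8`: `…_of_even_ge_eight`;  `q = 7`: `…_mod_seven` (`χ(2) ≠ 1`) or, when `χ(2) = 1`, `χ = (−7/·)` is odd and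
  `…_of_odd_ge` (`q ≥ 6`, minorant transfer) applies;  `q = 6`: `(ℤ/6)ˣ = {±1}` so `χ ≠ 1` is odd, same theorem;
* `q = 5`: `χ(2)² = χ(−1)`: even `χ ≠ 1` has `χ(2) = −1` — the NEW kernel-checked cell `CellMod5Log3Half` (door E of the twisted
  format-C lane); odd `χ` has `χ(2) = ±i` — the format-D-K certificates `DualTrigCertMod5OddChi2{I,NegI}Log3Half` (weil-grh-3);
* `q = 4`: format-D-K certificate `DualTrigCertMod4OddLog3Half`;  `q = 3`: the NEW kernel-checked cell `CellMod3Log3Half`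
  (hybrid door H);  `q = 2`: no `χ ≠ 1`;  `q = 1`: `ζ` itself.

Main theorems: `weilPositivityOnChar_log_three_half_of_ne_one` (every `χ ≠ 1`, every modulus `q ≥ 3`) and
`weilPositivityOnChar_log_three_half_of_isPrimitive` (every primitive `χ`, every modulus).
-/

noncomputable section

open DirichletCharacter Complex
open Literature.NumberTheory.LFunctions
open scoped Real ComplexConjugate

namespace Summit.Ventures.WeilGRH

variable {q : ℕ}

/-! ## Generators of small unit groups -/

/-- `(ℤ/6)ˣ = {±1}`. [folklore] -/
theorem units_mod_six : ∀ u : (ZMod 6)ˣ, u = 1 ∨ u = -1 := by decide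

/-! ## The small moduli -/

/-- `q = 5`: every `χ ≠ 1` mod 5 at `(log 3)/2` (`χ(2) = −1`: twisted format-C cell; `χ(2) = ±i`: format-D-K). [folklore] -/
theorem weilPositivityOnChar_log_three_half_mod_five (χ : DirichletCharacter ℂ 5) (hχ : χ ≠ 1) :
    WeilPositivityOnChar χ (Real.log 3 / 2) := by
  -- `χ(2)² = χ(4) = χ(−1) = ±1`
  have hsq : χ (2 : ZMod 5) * χ (2 : ZMod 5) = χ (-1) := by
    rw [← map_mul, show ((2 : ZMod 5) * 2) = -1 from by decide]
  rcases χ.even_or_odd with he | ho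
  · -- even: `χ(2) = ±1`; `χ(2) = 1` would force `χ = 1`
    have h1 : χ (2 : ZMod 5) * χ (2 : ZMod 5) = 1 := by rw [hsq]; exact he
    rcases mul_self_eq_one_iff.mp h1 with h | h
    · exact absurd (RealCharacterSmallModuli.eq_one_of_apply_gen RealCharacterSmallModuli.units_mod_five_gen h) hχ
    · exact CellMod5Log3Half.weilPositivityOnChar_mod_five_log_three_half χ h
  · -- odd: `χ(2)² = −1`, so `χ(2) = ±i`
    have h1 : (χ (2 : ZMod 5) - I) * (χ (2 : ZMod 5) + I) = 0 := by
      have hI : I * I = -1 := Complex.I_mul_I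
      have h2 : χ (2 : ZMod 5) * χ (2 : ZMod 5) = -1 := by rw [hsq]; exact ho
      linear_combination h2 - hI
    rcases mul_eq_zero.mp h1 with h | h
    · exact weilPositivityOnChar_mod5_odd_chi2_I_log3half χ (charParity_of_odd ho) (by linear_combination h)
    · exact weilPositivityOnChar_mod5_odd_chi2_negI_log3half χ (charParity_of_odd ho) (by linear_combination h)

/-- `q = 7`: every `χ ≠ 1` mod 7 at `(log 3)/2` (`χ(2) ≠ 1`: reflection; `χ(2) = 1`: `χ = (−7/·)` is odd). [folklore] -/
theorem weilPositivityOnChar_log_three_half_mod_seven_of_ne_one (χ : DirichletCharacter ℂ 7) (hχ : χ ≠ 1) :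
    WeilPositivityOnChar χ (Real.log 3 / 2) := by
  by_cases h2 : χ (2 : ZMod 7) = 1
  · -- `χ(3)² = χ(2) = 1`, `χ(3) ≠ 1` (else `χ = 1`), so `χ(3) = −1` and `χ(−1) = χ(6) = χ(2)χ(3) = −1`
    have h9 : χ (3 : ZMod 7) * χ (3 : ZMod 7) = 1 := by
      rw [← map_mul, show ((3 : ZMod 7) * 3) = 2 from by decide, h2]
    have h3 : χ (3 : ZMod 7) = -1 := by
      rcases mul_self_eq_one_iff.mp h9 with h | h
      · exact absurd (RealCharacterSmallModuli.eq_one_of_apply_gen RealCharacterSmallModuli.units_mod_seven_gen h) hχ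
      · exact h
    have hodd : χ.Odd := by
      show χ (-1) = -1
      rw [show (-1 : ZMod 7) = 2 * 3 from by decide, map_mul, h2, h3]; simp
    exact weilPositivityOnChar_log_three_half_of_odd_ge (by norm_num) χ (charParity_of_odd hodd)
  · exact weilPositivityOnChar_log_three_half_mod_seven χ h2

/-- `q = 9`: every `χ ≠ 1` mod 9 at `(log 3)/2` (`2` generates `(ℤ/9)ˣ`, so `χ(2) ≠ 1`). [folklore] -/
theorem weilPositivityOnChar_log_three_half_mod_nine_of_ne_one (χ : DirichletCharacter ℂ 9) (hχ : χ ≠ 1) :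
    WeilPositivityOnChar χ (Real.log 3 / 2) :=
  weilPositivityOnChar_log_three_half_mod_nine χ fun h ↦ hχ (RealCharacterSmallModuli.eq_one_of_apply_gen RealCharacterSmallModuli.units_mod_nine_gen h)

/-! ## Every modulus -/

/-- ★ **The `ζ` base rung `(log 3)/2` for EVERY non-principal Dirichlet character of EVERY modulus `q ≥ 3`.**
[cite: Yoshida1992, Thm 1 (p. 310); Weil1952FormulesExplicites, the «lemme» p. 262] -/
theorem weilPositivityOnChar_log_three_half_of_ne_one (hq : 3 ≤ q) (χ : DirichletCharacter ℂ q) (hχ : χ ≠ 1) :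
    WeilPositivityOnChar χ (Real.log 3 / 2) := by
  by_cases h10 : 10 ≤ q
  · exact weilPositivityOnChar_log_three_half_of_ge_ten h10 χ
  · obtain rfl | rfl | rfl | rfl | rfl | rfl | rfl : q = 3 ∨ q = 4 ∨ q = 5 ∨ q = 6 ∨ q = 7 ∨ q = 8 ∨ q = 9 := by omega
    · exact CellMod3Log3Half.weilPositivityOnChar_mod_three_log_three_half χ hχ
    · exact weilPositivityOnChar_mod4_odd_log3half χ
        (charParity_of_odd (odd_of_ne_one_of_le_four (by norm_num) (by norm_num) hχ))
    · exact weilPositivityOnChar_log_three_half_mod_five χ hχ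
    · exact weilPositivityOnChar_log_three_half_of_odd_ge le_rfl χ
        (charParity_of_odd (odd_of_ne_one_of_units units_mod_six hχ))
    · exact weilPositivityOnChar_log_three_half_mod_seven_of_ne_one χ hχ
    · exact weilPositivityOnChar_log_three_half_of_even_ge_eight le_rfl (by decide) χ
    · exact weilPositivityOnChar_log_three_half_mod_nine_of_ne_one χ hχ

/-- Every window `a ≤ (log 3)/2` for every non-principal character of every modulus `q ≥ 3`. [folklore] -/
theorem weilPositivityOnChar_of_le_log_three_half_of_ne_one (hq : 3 ≤ q) (χ : DirichletCharacter ℂ q) (hχ : χ ≠ 1)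
    {a : ℝ} (ha : a ≤ Real.log 3 / 2) : WeilPositivityOnChar χ a :=
  (weilPositivityOnChar_log_three_half_of_ne_one hq χ hχ).mono ha

/-- ★★ **Yoshida's base rung for every Dirichlet `L`-function**: Weil positivity on `[−(log 3)/2, (log 3)/2]` —
`Re W_χ(g ⋆ g̃) ≥ 0` for every smooth `g` supported there — holds for EVERY primitive Dirichlet character of EVERY
modulus (`q = 1`: `ζ`, Yoshida 1992). [cite: Yoshida1992, Thm 1 (p. 310); Weil1952FormulesExplicites, the «lemme» p. 262] -/
theorem weilPositivityOnChar_log_three_half_of_isPrimitive [NeZero q] (χ : DirichletCharacter ℂ q)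
    (hχ : χ.IsPrimitive) : WeilPositivityOnChar χ (Real.log 3 / 2) := by
  by_cases h3 : 3 ≤ q
  · exact weilPositivityOnChar_log_three_half_of_ne_one h3 χ (ne_one_of_isPrimitive (by omega) hχ)
  · have hq0 : q ≠ 0 := NeZero.ne q
    obtain rfl | rfl : q = 1 ∨ q = 2 := by omega
    · exact (weilPositivityOnChar_modOne_iff χ _).2 weilPositivityOn_log_three_half
    · have h1 : χ = 1 := by
        ext u
        obtain rfl : u = 1 := by revert u; decide
        simp
      exact absurd h1 (ne_one_of_isPrimitive (by norm_num) hχ)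

/-- Every window `a ≤ (log 3)/2` for every primitive Dirichlet character of every modulus. [folklore] -/
theorem weilPositivityOnChar_of_le_log_three_half_of_isPrimitive [NeZero q] (χ : DirichletCharacter ℂ q)
    (hχ : χ.IsPrimitive) {a : ℝ} (ha : a ≤ Real.log 3 / 2) : WeilPositivityOnChar χ a :=
  (weilPositivityOnChar_log_three_half_of_isPrimitive χ hχ).mono ha

end Summit.Ventures.WeilGRH

end
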